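import Summits.Ventures.YMGap.Thresholds.StarSU3CertifiedDimRows
import Summits.Ventures.YMGap.Thresholds.OneLinkVarianceSDCentred
import HarnessLib

/-!
# Venture YMGap — `SU(3)` in EVERY dimension, HYPOTHESIS-FREE: ds-1's general-dimension star door fed by the centred Schwinger–Dyson modulus
# `K_PV2` ⇒ `MassGapAt d 3 (β_W/9)` at every Wilson `(d−1)|β_W| ≤ 19/20` (every `d ≥ 2`), and the sharper small-`d` rows

HONEST FRAMING: venture file of the cell `pub-ymgap` (QuantumFields programme), seat engine-2 (g10); 0 compute, 0 def.  Strong-coupling LATTICE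
statements only (`SU(3)` lattice Yang–Mills on `ℤ^d`, Wilson plaquette weight, tree coupling `β_W/3`, 't Hooft `β_W/9`): DLR uniqueness + exponential
clustering (`MassGapAt`).  Nothing about the continuum, weak coupling, or the Clay problem; class K OUTRIGHT (no displayed hypothesis).
Kernel ARITHMETIC over tree theorems: ds-1's socket-fed row `StarDimMassGap.massGapAt_of_oneLinkKRModulus` (door `doorPoly d (K|x|) < 1`, tilt
radius `2(d−1)|x| ≤ R`) fed with this seat's HYPOTHESIS-FREE centred modulus `OneLinkVarianceSDCentred.su3_oneLinkKRModulus_pv2_of_le`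
(`16τ(τ−1) + 9τ³R² ≤ 16(τ−1)K²(1/2−R)`):
* `su3_massGapAt_dim_pv2` (schema, every `d ≥ 2`): modulus radius `R_m ≥ 2(d−1)|β_W|/9`, envelope at `R_m`, door `doorPoly d (K|β_W|/9) < 1`;
* ★ `su3_massGapAt_dim_pv2_uniform` (EVERY `d ≥ 2`): `(d−1)|β_W| ≤ 19/20` ⇒ `MassGapAt d 3 (β_W/9)` — one certificate `K = 110233/50000` at the fixed
  radius `19/90`, the door closing by `doorPoly d c ≤ 4a − 2c(1 − 2a) < 1` with `(d−1)c ≤ a = (19/180)K`, `4a = 0.93086`;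
* small-`d` rows at their own radii: `d = 3`: `|β_W| ≤ 53/100` (`K(53/225) = 58823/25000`, door `0.98496`); `d = 4`: `|β_W| ≤ 87/250` (`K(29/125) =
  46603/20000`, door `0.99841`); `d = 5`: `|β_W| ≤ 1/4` (`K(2/9) = 226971/100000`, door `0.94626`); `d = 6`: `|β_W| ≤ 41/200` (`K(41/180) = 230367/100000`,
  door `0.99957`); the same rows in the SC-a currency `DLRMassGapAt` and the d = 3, 4 phase predicates `HessianSharp.StrongCouplingPhaseAt`;
  track (a): `ImprovedThreshold 3 3 (53/900)`, `ImprovedThreshold 4 3 (29/750)`, `ImprovedThreshold 5 3 (1/36)`, `ImprovedThreshold 6 3 (41/1800)`.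
WHAT MOVES (hypothesis-free `SU(3)`, this predicate): the all-`N` rows (ds-1 / p2) give `(d−1)|β_W| ≤ 3/4`-type windows (`d = 3`: `|β_W| ≤ 2/5` via
`ImprovedThreshold 3 N (2/45)`); engine-2 g9's `SU(3)` PV row was `d = 4` only (`|β_W| ≤ 63/200`).  Here: every `d`: `(d−1)|β_W| ≤ 19/20`; `d = 3`: `0.53`;
`d = 4`: `0.348`; `d = 5`: `0.25`; `d = 6`: `0.205`.  The CONDITIONAL rows (H1 ∧ H2, `StarSU3CertifiedDimRows`: `(d−1)|β_W| ≤ 33/20`, `d ≤ 10`) are untouched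
and remain larger.  Certificates: exact rationals, `HOME/pub-ymgap-engine-2/pv2/cert_rows.py` (`modulus_pv2`), one `norm_num` each.
-/

noncomputable section

open MeasureTheory ProbabilityTheory Function Finset
open Literature.Probability.LatticeModels
open Literature.MathematicalPhysics.QuantumLattice (fundamentalRep ymSpecification)
open Literature.MathematicalPhysics.QuantumFieldTheory
open Literature.MathematicalPhysics.QuantumFieldTheory.Balaban1983to89
open Literature.MathematicalPhysics.QuantumFieldTheory.Balaban1983to89.StrongCouplingDobrushinWindow
  (OneLinkKRModulus DLRMassGapAt)
open Summit.Ventures.YMGap.StarResolventDim (doorPoly doorPoly_lt_one_mono)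
open Summit.Ventures.YMGap.StarSU3Certified (abs_div_nine)
open Summit.Ventures.YMGap.OneLinkVarianceSDC (su3_oneLinkKRModulus_pv2_of_le)

namespace Summit.Ventures.YMGap.StarSU3PV2Dim

variable {d : ℕ}

/-! ### 1. The socket-fed row in dimension `d`, hypothesis-free -/

/-- **`SU(3)`, dimension `d ≥ 2`, HYPOTHESIS-FREE: `MassGapAt d 3 (β_W/9)` from the centred Poincaré × Schwinger–Dyson modulus, door displayed.**
A modulus radius `R_m < 1/2` with `2(d−1)|β_W|/9 ≤ R_m`, a multiplier `τ > 1`, a rational `K ≥ 0` with `16τ(τ−1) + 9τ³R_m² ≤ 16(τ−1)K²(1/2−R_m)` and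
ds-1's door `doorPoly d (K|β_W|/9) < 1` give DLR uniqueness + exponential clustering for `SU(3)` at 't Hooft `β_W/9`. [folklore] -/
theorem su3_massGapAt_dim_pv2 (hd : 2 ≤ d) {βW Rm τ K : ℝ} (hR : |βW| / 9 * (2 * ((d : ℝ) - 1)) ≤ Rm) (hRm : Rm < 1 / 2) (hτ : 1 < τ)
    (hK0 : 0 ≤ K) (hK : 16 * τ * (τ - 1) + 9 * τ ^ 3 * Rm ^ 2 ≤ 16 * (τ - 1) * (K ^ 2 * (1 / 2 - Rm)))
    (hdoor : doorPoly d (K * (|βW| / 9)) < 1) : MassGapAt d 3 (βW / 9) := by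
  refine StarDimMassGap.massGapAt_of_oneLinkKRModulus hd (by norm_num) hK0 ?_ (su3_oneLinkKRModulus_pv2_of_le hRm hτ hK0 hK) ?_
  · rw [abs_div_nine]; exact hR
  · rw [abs_div_nine]; exact hdoor

/-- The uniform door arithmetic: if `c ≥ 0`, `(d−1)·c ≤ a`, `a ≤ 1/2` and `4a < 1` then `doorPoly d c < 1`
(`doorPoly d c = 4((d−1)c)c + 4(d−1)c − 2c ≤ 4a − 2c(1 − 2a) ≤ 4a`). [folklore] -/
theorem doorPoly_lt_one_of_uniform (hd : 2 ≤ d) {c a : ℝ} (hc : 0 ≤ c) (hca : ((d : ℝ) - 1) * c ≤ a) (ha2 : a ≤ 1 / 2)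
    (ha : 4 * a < 1) : doorPoly d c < 1 := by
  have hd' : (2 : ℝ) ≤ d := by exact_mod_cast hd
  unfold doorPoly
  have h1 : (4 * (d : ℝ) - 4) * c ^ 2 ≤ 4 * a * c := by
    have := mul_le_mul_of_nonneg_right hca hc
    nlinarith
  have h2 : (4 * (d : ℝ) - 6) * c ≤ 4 * a - 2 * c := by nlinarith
  nlinarith

/-! ### 2. ★ Every dimension: `(d−1)|β_W| ≤ 19/20` -/

/-- ★ **`SU(3)`, EVERY DIMENSION `d ≥ 2`, HYPOTHESIS-FREE: `MassGapAt d 3 (β_W/9)` at every Wilson `(d−1)|β_W| ≤ 19/20`** — DLR uniqueness on `ℤ^d`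
and exponential clustering for every DLR state.  One certificate: the centred modulus `K = 110233/50000` (`τ = 144/125`) at the fixed tilt radius
`19/90 ≥ 2(d−1)|β_W|/9`, and the door through `doorPoly_lt_one_of_uniform` with `a = (19/180)·K` (`4a = 0.9309 < 1`).  Rows: `d = 3`: `|β_W| ≤ 19/40`;
`d = 4`: `19/60`; `d = 5`: `19/80`; large `d`: `0.95/(d−1)` (all-`N` hypothesis-free rows: `(d−1)|β_W| ≤ 3/4`-type). [folklore] -/
theorem su3_massGapAt_dim_pv2_uniform (hd : 2 ≤ d) {βW : ℝ} (h : ((d : ℝ) - 1) * |βW| ≤ 19 / 20) : MassGapAt d 3 (βW / 9) := by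
  have hd' : (2 : ℝ) ≤ d := by exact_mod_cast hd
  have hβ : 0 ≤ |βW| := abs_nonneg βW
  refine su3_massGapAt_dim_pv2 hd (Rm := 19 / 90) (τ := 144 / 125) (K := 110233 / 50000) (by linarith) (by norm_num) (by norm_num)
    (by norm_num) (by norm_num) ?_
  refine doorPoly_lt_one_of_uniform hd (a := 19 / 180 * (110233 / 50000)) (by positivity) ?_ (by norm_num) (by norm_num)
  nlinarith

/-- ★ The same row in the SC-a currency: `DLRMassGapAt d 3 (β_W/9)` at every `(d−1)|β_W| ≤ 19/20`, every `d ≥ 2`, hypothesis-free. [folklore] -/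
theorem su3_dlrMassGapAt_dim_pv2_uniform (hd : 2 ≤ d) {βW : ℝ} (h : ((d : ℝ) - 1) * |βW| ≤ 19 / 20) : DLRMassGapAt d 3 (βW / 9) :=
  massGapAt_iff_dlrMassGapAt.1 (su3_massGapAt_dim_pv2_uniform hd h)

/-! ### 3. Small-`d` rows at their own radii -/

/-- **`SU(3)`, `d = 3`, HYPOTHESIS-FREE: `MassGapAt 3 3 (β_W/9)` at every Wilson `|β_W| ≤ 53/100`** (`K(53/225) = 58823/25000`, `τ = 146/125`; door
`8c² + 6c = 0.98496 < 1` at `c = K·53/900`; the all-`N` row gave `2/5`, the conditional H1 ∧ H2 row `33/40`). [folklore] -/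
theorem su3_three_massGapAt_pv2 {βW : ℝ} (h : |βW| ≤ 53 / 100) : MassGapAt 3 3 (βW / 9) := by
  have hβ : 0 ≤ |βW| := abs_nonneg βW
  refine su3_massGapAt_dim_pv2 (by norm_num) (Rm := 53 / 225) (τ := 146 / 125) (K := 58823 / 25000) (by push_cast; linarith)
    (by norm_num) (by norm_num) (by norm_num) (by norm_num) ?_
  exact doorPoly_lt_one_mono (by norm_num) (by positivity) (by linarith : 58823 / 25000 * (|βW| / 9) ≤ 58823 / 25000 * ((53 / 100 : ℝ) / 9))
    (by unfold doorPoly; norm_num)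

/-- **`SU(3)`, `d = 4`, HYPOTHESIS-FREE: `MassGapAt 4 3 (β_W/9)` at every Wilson `|β_W| ≤ 87/250 = 0.348`** (`K(29/125) = 46603/20000`, `τ = 583/500`;
door `12c² + 10c = 0.99841`; engine-2 g9: `63/200` via `ImprovedThreshold 4 3 (7/200)`; this seat's `ImprovedThreshold 4 3 (77/2000)` reads `0.3465`). [folklore] -/
theorem su3_four_massGapAt_pv2 {βW : ℝ} (h : |βW| ≤ 87 / 250) : MassGapAt 4 3 (βW / 9) := by
  have hβ : 0 ≤ |βW| := abs_nonneg βW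
  refine su3_massGapAt_dim_pv2 (by norm_num) (Rm := 29 / 125) (τ := 583 / 500) (K := 46603 / 20000) (by push_cast; linarith)
    (by norm_num) (by norm_num) (by norm_num) (by norm_num) ?_
  exact doorPoly_lt_one_mono (by norm_num) (by positivity) (by linarith : 46603 / 20000 * (|βW| / 9) ≤ 46603 / 20000 * ((87 / 250 : ℝ) / 9))
    (by unfold doorPoly; norm_num)

/-- **`SU(3)`, `d = 5`, HYPOTHESIS-FREE: `MassGapAt 5 3 (β_W/9)` at every Wilson `|β_W| ≤ 1/4`** (`K(2/9) = 226971/100000`, `τ = 29/25`; door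
`16c² + 14c = 0.94626`). [folklore] -/
theorem su3_five_massGapAt_pv2 {βW : ℝ} (h : |βW| ≤ 1 / 4) : MassGapAt 5 3 (βW / 9) := by
  have hβ : 0 ≤ |βW| := abs_nonneg βW
  refine su3_massGapAt_dim_pv2 (by norm_num) (Rm := 2 / 9) (τ := 29 / 25) (K := 226971 / 100000) (by push_cast; linarith)
    (by norm_num) (by norm_num) (by norm_num) (by norm_num) ?_
  exact doorPoly_lt_one_mono (by norm_num) (by positivity) (by linarith : 226971 / 100000 * (|βW| / 9) ≤ 226971 / 100000 * ((1 / 4 : ℝ) / 9))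
    (by unfold doorPoly; norm_num)

/-- **`SU(3)`, `d = 6`, HYPOTHESIS-FREE: `MassGapAt 6 3 (β_W/9)` at every Wilson `|β_W| ≤ 41/200`** (`K(41/180) = 230367/100000`, `τ = 581/500`; door
`20c² + 18c = 0.99957`). [folklore] -/
theorem su3_six_massGapAt_pv2 {βW : ℝ} (h : |βW| ≤ 41 / 200) : MassGapAt 6 3 (βW / 9) := by
  have hβ : 0 ≤ |βW| := abs_nonneg βW
  refine su3_massGapAt_dim_pv2 (by norm_num) (Rm := 41 / 180) (τ := 581 / 500) (K := 230367 / 100000) (by push_cast; linarith)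
    (by norm_num) (by norm_num) (by norm_num) (by norm_num) ?_
  exact doorPoly_lt_one_mono (by norm_num) (by positivity) (by linarith : 230367 / 100000 * (|βW| / 9) ≤ 230367 / 100000 * ((41 / 200 : ℝ) / 9))
    (by unfold doorPoly; norm_num)

/-- The `d = 3` row in the SC-a currency: `DLRMassGapAt 3 3 (β_W/9)` at every `|β_W| ≤ 53/100`, hypothesis-free. [folklore] -/
theorem su3_three_dlrMassGapAt_pv2 {βW : ℝ} (h : |βW| ≤ 53 / 100) : DLRMassGapAt 3 3 (βW / 9) :=
  massGapAt_iff_dlrMassGapAt.1 (su3_three_massGapAt_pv2 h)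

/-- The `d = 4` row in the SC-a currency: `DLRMassGapAt 4 3 (β_W/9)` at every `|β_W| ≤ 87/250`, hypothesis-free. [folklore] -/
theorem su3_four_dlrMassGapAt_pv2 {βW : ℝ} (h : |βW| ≤ 87 / 250) : DLRMassGapAt 4 3 (βW / 9) :=
  massGapAt_iff_dlrMassGapAt.1 (su3_four_massGapAt_pv2 h)

/-- The `d = 3` row as p2's strong-coupling PHASE predicate `HessianSharp.StrongCouplingPhaseAt 3 3 (β_W/3)` at every `|β_W| ≤ 53/100`, hypothesis-free
(bridge `strongCouplingPhaseAt_of_massGapAt`). [folklore] -/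
theorem su3_three_strongCouplingPhaseAt_pv2 {βW : ℝ} (h : |βW| ≤ 53 / 100) : HessianSharp.StrongCouplingPhaseAt 3 3 (βW / 3) := by
  refine HessianSharp.strongCouplingPhaseAt_of_massGapAt (by norm_num) (by norm_num) ?_
  have e : βW / 3 / ((3 : ℕ) : ℝ) = βW / 9 := by push_cast; ring
  rw [e]
  exact su3_three_massGapAt_pv2 h

/-- The `d = 4` row as the PHASE predicate `HessianSharp.StrongCouplingPhaseAt 4 3 (β_W/3)` at every `|β_W| ≤ 87/250`, hypothesis-free. [folklore] -/
theorem su3_four_strongCouplingPhaseAt_pv2 {βW : ℝ} (h : |βW| ≤ 87 / 250) : HessianSharp.StrongCouplingPhaseAt 4 3 (βW / 3) := by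
  refine HessianSharp.strongCouplingPhaseAt_of_massGapAt (by norm_num) (by norm_num) ?_
  have e : βW / 3 / ((3 : ℕ) : ℝ) = βW / 9 := by push_cast; ring
  rw [e]
  exact su3_four_massGapAt_pv2 h

/-! ### 4. Track (a) in dimensions 3, 4, 5, 6 -/

/-- **`ImprovedThreshold 3 3 (53/900)`, HYPOTHESIS-FREE** (`SU(3)`, `d = 3`: mass gap at every 't Hooft `|x| < 53/900 = 0.0589`, Wilson `β_W < 0.53`;
Shen–Zhu–Zhu `1/32`; the all-`N` hypothesis-free row reads `2/45 = 0.0444`). [folklore] -/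
theorem improvedThreshold_su3_three_pv2 : ImprovedThreshold 3 3 (53 / 900) :=
  ⟨by norm_num, fun x hx => by
    have h := su3_three_massGapAt_pv2 (βW := 9 * x) (by rw [abs_mul, abs_of_pos (by norm_num : (0 : ℝ) < 9)]; linarith [hx.le])
    rwa [show 9 * x / 9 = x by ring] at h⟩

/-- **`ImprovedThreshold 4 3 (29/750)`, HYPOTHESIS-FREE** (`SU(3)`, `d = 4`: `29/750 = 0.03867`, Wilson `β_W < 0.348`; this seat's `ImprovedThresholdSU3PV2`
reads `77/2000 = 0.0385` through ds-1's `4K|x| ≤ 9/25` form of the same door; Shen–Zhu–Zhu `1/48`). [folklore] -/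
theorem improvedThreshold_su3_four_pv2 : ImprovedThreshold 4 3 (29 / 750) :=
  ⟨by norm_num, fun x hx => by
    have h := su3_four_massGapAt_pv2 (βW := 9 * x) (by rw [abs_mul, abs_of_pos (by norm_num : (0 : ℝ) < 9)]; linarith [hx.le])
    rwa [show 9 * x / 9 = x by ring] at h⟩

/-- **`ImprovedThreshold 5 3 (1/36)`, HYPOTHESIS-FREE** (`SU(3)`, `d = 5`: Wilson `β_W < 1/4`; Shen–Zhu–Zhu `1/64`). [folklore] -/
theorem improvedThreshold_su3_five_pv2 : ImprovedThreshold 5 3 (1 / 36) :=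
  ⟨by norm_num, fun x hx => by
    have h := su3_five_massGapAt_pv2 (βW := 9 * x) (by rw [abs_mul, abs_of_pos (by norm_num : (0 : ℝ) < 9)]; linarith [hx.le])
    rwa [show 9 * x / 9 = x by ring] at h⟩

/-- **`ImprovedThreshold 6 3 (41/1800)`, HYPOTHESIS-FREE** (`SU(3)`, `d = 6`: Wilson `β_W < 41/200`; Shen–Zhu–Zhu `1/80`). [folklore] -/
theorem improvedThreshold_su3_six_pv2 : ImprovedThreshold 6 3 (41 / 1800) :=
  ⟨by norm_num, fun x hx => by
    have h := su3_six_massGapAt_pv2 (βW := 9 * x) (by rw [abs_mul, abs_of_pos (by norm_num : (0 : ℝ) < 9)]; linarith [hx.le])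
    rwa [show 9 * x / 9 = x by ring] at h⟩

end Summit.Ventures.YMGap.StarSU3PV2Dim

end
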